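import Literature.Computability.Cryptography.WordRAMPrattRepetition
import Literature.Computability.AlgebraicComplexity.PrattEvaluationData
import Mathlib.Combinatorics.Colex
import Mathlib.Data.Nat.Digits.Defs
import HarnessLib

/-!
# Pratt's balanced-tripartitioning machine — semantics of the masks

Mathematical glue between the word-RAM program `SProg.prattProg` (`WordRAMPrattMain`) and the
combinatorics of K. Pratt, STOC 2024, proof of Thm. 1.9 (instalment of the proof of
`Literature.Computability.AlgebraicComplexity.pratt2024_thm_1_9`):

* binary codes of finite sets (`setCode` = Mathlib's `Finset.equivBitIndices.symm`, injective by
  `Finset.geomSum_injective`; `setCode_Ico` for the pad masks), the block-balanced set `Aset k r idx`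
  numbered by a flat index and the identification `maskOf = setCode (g '' Aset)` of the machine's
  pattern-mask sum (`maskOf_eq_setCode`), base-`C` numbers from digits (`ofDigitsC` =
  `Nat.ofDigits`, `digit_ofDigitsC`) and the numbering `idxOf` of a block-balanced set with
  `Aset (idxOf Y) = Y` (`Aset_idxOf`);
* (namespace `PrattWords`) the input words of a `TripartitioningInstance` (`wordEncode`) read
  positionally: family lengths, cardinality words and element words
  (`getD_wordEncode_len/card/elem`), the code of a listed set as the sum over its element words
  (`sum_pow_elems`), and `HasTripartition` as "three pairwise disjoint listed sets"
  (`hasTripartition_iff`).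

## References

* K. Pratt, *A stronger connection between the asymptotic rank conjecture and the set cover
  conjecture*, STOC 2024, arXiv:2311.02774, §2 (proof of Thm. 1.9).
-/

namespace Literature.Computability.AlgebraicComplexity

open Finset Literature.Computability.Cryptography.WordRAM

/-! ## Binary codes of finite sets -/

/-- The binary code `∑_{e ∈ S} 2^e` of a finite set of naturals — Mathlib's
`Finset.equivBitIndices.symm` (`setCode_eq`); kept as a name for the masks the machine forms.
[folklore] -/
def setCode (S : Finset ℕ) : ℕ := ∑ e ∈ S, 2 ^ e

/-- `setCode` is the inverse of Mathlib's `Finset.equivBitIndices`. [folklore] -/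
theorem setCode_eq (S : Finset ℕ) : setCode S = Finset.equivBitIndices.symm S := rfl

/-- Code of the empty set. [folklore] -/
@[simp] theorem setCode_empty : setCode ∅ = 0 := by simp [setCode]

/-- Code of a disjoint union. [folklore] -/
theorem setCode_union {S T : Finset ℕ} (h : Disjoint S T) : setCode (S ∪ T) = setCode S + setCode T := by
  simp [setCode, sum_union h]

/-- Codes of subsets of `[M]` are `< 2^M`. [folklore] -/
theorem setCode_lt_two_pow {S : Finset ℕ} {M : ℕ} (h : ∀ e ∈ S, e < M) : setCode S < 2 ^ M := by
  unfold setCode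
  calc ∑ e ∈ S, 2 ^ e ≤ ∑ e ∈ range M, 2 ^ e := sum_le_sum_of_subset fun e he => mem_range.2 (h e he)
    _ = 2 ^ M - 1 := sum_range_two_pow M
    _ < 2 ^ M := by have := Nat.one_le_two_pow (n := M); omega

/-- **Codes determine sets** (`Finset.geomSum_injective`). [folklore] -/
theorem setCode_injective : Function.Injective setCode := Finset.geomSum_injective le_rfl

/-- The code of an interval `[a, a + d)` is `(2^d - 1) 2^a`. [folklore] -/
theorem setCode_Ico (a d : ℕ) : setCode (Ico a (a + d)) = (2 ^ d - 1) * 2 ^ a := by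
  unfold setCode
  rw [Finset.sum_Ico_eq_sum_range, Nat.add_sub_cancel_left]
  rw [show ∑ k ∈ range d, 2 ^ (a + k) = 2 ^ a * ∑ k ∈ range d, 2 ^ k by
    rw [mul_sum]; exact sum_congr rfl fun k _ => by rw [pow_add]]
  rw [sum_range_two_pow, Nat.mul_comm]

/-! ## Block-balanced sets numbered by flat indices -/

/-- The part of block `u` selected by pattern number `j`: `{3k u + i : i ∈ blockOf k j}`. [cite: Pratt2024SCC, §2 (proof of Thm. 1.9)] -/
noncomputable def prattBlockPart (k u j : ℕ) : Finset ℕ := ((blockOf k j).1).image fun i : Fin (3 * k) => u * (3 * k) + (i : ℕ)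

/-- The block-balanced subset of `[r · 3k]` numbered by the flat index `idx`. [cite: Pratt2024SCC, §2 (proof of Thm. 1.9)] -/
noncomputable def Aset (k r idx : ℕ) : Finset ℕ := (range r).biUnion fun u => prattBlockPart k u (digit (prattC k) u idx)

/-- Elements of a block part lie in their block. [folklore] -/
theorem mem_prattBlockPart {k u j p : ℕ} : p ∈ prattBlockPart k u j ↔
    ∃ i : Fin (3 * k), i ∈ (blockOf k j).1 ∧ p = u * (3 * k) + i := by
  unfold prattBlockPart; rw [mem_image]
  exact ⟨fun ⟨i, hi, he⟩ => ⟨i, hi, he.symm⟩, fun ⟨i, hi, he⟩ => ⟨i, hi, he.symm⟩⟩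

/-- Block parts lie in `[u · 3k, (u+1) · 3k)`. [folklore] -/
theorem prattBlockPart_bounds {k u j p : ℕ} (h : p ∈ prattBlockPart k u j) : u * (3 * k) ≤ p ∧ p < (u + 1) * (3 * k) := by
  obtain ⟨i, _, rfl⟩ := mem_prattBlockPart.1 h
  have := i.2
  have h3 : (u + 1) * (3 * k) = u * (3 * k) + 3 * k := by ring
  constructor
  · omega
  · omega

/-- A block part has `k` elements. [folklore] -/
theorem card_prattBlockPart (k u j : ℕ) : (prattBlockPart k u j).card = k := by
  unfold prattBlockPart
  rw [card_image_of_injective _ (fun i i' h => Fin.ext (by simpa using h))]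
  exact (blockOf k j).2

/-- Block parts of distinct blocks are disjoint. [folklore] -/
theorem disjoint_prattBlockPart {k u u' j j' : ℕ} (h : u ≠ u') : Disjoint (prattBlockPart k u j) (prattBlockPart k u' j') := by
  rw [Finset.disjoint_left]
  intro p hp hp'
  obtain ⟨h1, h2⟩ := prattBlockPart_bounds hp
  obtain ⟨h3, h4⟩ := prattBlockPart_bounds hp'
  rcases Nat.lt_or_gt_of_ne h with hu | hu
  · have : (u + 1) * (3 * k) ≤ u' * (3 * k) := Nat.mul_le_mul_right _ hu
    omega
  · have : (u' + 1) * (3 * k) ≤ u * (3 * k) := Nat.mul_le_mul_right _ hu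
    omega

/-- In one block, disjoint patterns give disjoint parts. [folklore] -/
theorem disjoint_prattBlockPart_same {k u j j' : ℕ} (h : Disjoint (blockOf k j).1 (blockOf k j').1) :
    Disjoint (prattBlockPart k u j) (prattBlockPart k u j') := by
  rw [Finset.disjoint_left]
  intro p hp hp'
  obtain ⟨i, hi, rfl⟩ := mem_prattBlockPart.1 hp
  obtain ⟨i', hi', he⟩ := mem_prattBlockPart.1 hp'
  have : i = i' := Fin.ext (by omega)
  subst this
  exact Finset.disjoint_left.1 h hi hi'

/-- Elements of `Aset` are below `r · 3k`. [folklore] -/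
theorem lt_of_mem_Aset {k r idx p : ℕ} (h : p ∈ Aset k r idx) : p < r * (3 * k) := by
  unfold Aset at h
  obtain ⟨u, hu, hp⟩ := mem_biUnion.1 h
  rw [mem_range] at hu
  have := (prattBlockPart_bounds hp).2
  have h1 : (u + 1) * (3 * k) ≤ r * (3 * k) := Nat.mul_le_mul_right _ hu
  omega

/-- `|Aset| = r k`. [folklore] -/
theorem card_Aset (k r idx : ℕ) : (Aset k r idx).card = r * k := by
  unfold Aset
  rw [card_biUnion (fun u _ u' _ h => disjoint_prattBlockPart h)]
  simp [card_prattBlockPart, mul_comm]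

/-- `AllDisjoint` (blockwise disjoint patterns) makes the three sets pairwise disjoint. [cite: Pratt2024SCC, §2 (proof of Thm. 1.9)] -/
theorem disjoint_Aset_of_allDisjoint {k r a b c : ℕ} (h : AllDisjoint k r a b c) :
    Disjoint (Aset k r a) (Aset k r b) ∧ Disjoint (Aset k r a) (Aset k r c) ∧ Disjoint (Aset k r b) (Aset k r c) := by
  have key : ∀ {x y : ℕ}, (∀ u, u < r → Disjoint (blockOf k (digit (prattC k) u x)).1 (blockOf k (digit (prattC k) u y)).1) →
      Disjoint (Aset k r x) (Aset k r y) := by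
    intro x y hxy
    unfold Aset
    rw [disjoint_biUnion_left]
    intro u hu
    rw [disjoint_biUnion_right]
    intro u' hu'
    rw [mem_range] at hu hu'
    by_cases huu : u = u'
    · subst huu; exact disjoint_prattBlockPart_same (hxy u hu)
    · exact disjoint_prattBlockPart huu
  exact ⟨key fun u hu => (h u hu).1, key fun u hu => (h u hu).2.1, key fun u hu => (h u hu).2.2⟩

/-! ## The machine's masks are codes -/

/-- The block-membership table as the glue reads it: `BM j i = [i ∈ blockOf k j]` for `i < 3k`. [folklore] -/
noncomputable def bmFun (k j i : ℕ) : ℕ := if h : i < 3 * k then (if (⟨i, h⟩ : Fin (3 * k)) ∈ (blockOf k j).1 then 1 else 0) else 0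

/-- `bmFun ≤ 1`. [folklore] -/
theorem bmFun_le_one (k j i : ℕ) : bmFun k j i ≤ 1 := by
  unfold bmFun; split_ifs <;> simp

/-- **One block's pattern mask** is `∑_{p ∈ prattBlockPart} 2^{g p}`. [cite: Pratt2024SCC, §2 (proof of Thm. 1.9)] -/
theorem ptOf_bmFun (k : ℕ) (g : ℕ → ℕ) (u j : ℕ) :
    SProg.ptOf (bmFun k) g (3 * k) u j = ∑ p ∈ prattBlockPart k u j, 2 ^ g p := by
  classical
  unfold SProg.ptOf prattBlockPart
  rw [sum_image (fun i _ i' _ h => Fin.ext (by simpa using h))]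
  rw [← Fin.sum_univ_eq_sum_range (fun i => bmFun k j i * 2 ^ g (u * (3 * k) + i))]
  rw [← sum_filter_add_sum_filter_not univ (fun i : Fin (3 * k) => i ∈ (blockOf k j).1)]
  rw [sum_eq_zero (s := univ.filter fun i : Fin (3 * k) => ¬ i ∈ (blockOf k j).1) (fun i hi => by
    rw [mem_filter] at hi
    unfold bmFun; rw [dif_pos i.2]; simp [hi.2]), add_zero]
  rw [show (univ.filter fun i : Fin (3 * k) => i ∈ (blockOf k j).1) = (blockOf k j).1 by ext i; simp]
  refine sum_congr rfl fun i hi => ?_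
  unfold bmFun; rw [dif_pos i.2]; simp [hi]

/-- **The mask of a flat index** is `∑_{p ∈ Aset} 2^{g p}`. [cite: Pratt2024SCC, §2 (proof of Thm. 1.9)] -/
theorem maskOf_bmFun (k r : ℕ) (g : ℕ → ℕ) (idx : ℕ) :
    SProg.maskOf (bmFun k) g (3 * k) (prattC k) r idx = ∑ p ∈ Aset k r idx, 2 ^ g p := by
  classical
  unfold SProg.maskOf Aset
  rw [sum_biUnion (fun u _ u' _ h => disjoint_prattBlockPart h)]
  exact sum_congr rfl fun u _ => ptOf_bmFun k g u _

/-- The code of an injective image. [folklore] -/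
theorem setCode_image {S : Finset ℕ} {g : ℕ → ℕ} (h : Set.InjOn g ↑S) : setCode (S.image g) = ∑ p ∈ S, 2 ^ g p := by
  unfold setCode; rw [sum_image h]

/-- **The mask is the code of the image set** for `g` injective on `[r · 3k]`. [cite: Pratt2024SCC, §2 (proof of Thm. 1.9)] -/
theorem maskOf_eq_setCode {k r : ℕ} {g : ℕ → ℕ}
    (hginj : ∀ p p', p < r * (3 * k) → p' < r * (3 * k) → g p = g p' → p = p') (idx : ℕ) :
    SProg.maskOf (bmFun k) g (3 * k) (prattC k) r idx = setCode ((Aset k r idx).image g) := by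
  rw [maskOf_bmFun, setCode_image]
  exact fun p hp p' hp' h => hginj p p' (lt_of_mem_Aset (mem_coe.1 hp)) (lt_of_mem_Aset (mem_coe.1 hp')) h

/-! ## Numbers from digits -/

/-- The number with base-`C` digits `e 0, …, e (r-1)` (least significant first): Mathlib's
`Nat.ofDigits C [e 0, …, e (r-1)]`. [folklore] -/
def ofDigitsC (C : ℕ) (e : ℕ → ℕ) (r : ℕ) : ℕ := Nat.ofDigits C ((List.range r).map e)

/-- No digits. [folklore] -/
@[simp] theorem ofDigitsC_zero (C : ℕ) (e : ℕ → ℕ) : ofDigitsC C e 0 = 0 := by simp [ofDigitsC]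

/-- The recursion on the number of digits (`Nat.ofDigits_cons`). [folklore] -/
theorem ofDigitsC_succ (C : ℕ) (e : ℕ → ℕ) (r : ℕ) :
    ofDigitsC C e (r + 1) = ofDigitsC C (fun u => e (u + 1)) r * C + e 0 := by
  unfold ofDigitsC
  rw [List.range_succ_eq_map, List.map_cons, List.map_map, Nat.ofDigits_cons]
  rw [Nat.mul_comm, Nat.add_comm]
  rfl

/-- `ofDigitsC < C^r` for digits `< C`. [folklore] -/
theorem ofDigitsC_lt {C : ℕ} : ∀ {e : ℕ → ℕ} (r : ℕ), (∀ u, u < r → e u < C) → ofDigitsC C e r < C ^ r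
  | e, 0, _ => by simp
  | e, r + 1, h => by
    rw [ofDigitsC_succ, pow_succ]
    exact mul_add_lt_mul (ofDigitsC_lt r fun u hu => h (u + 1) (by omega)) (h 0 (by omega))

/-- The digits of `ofDigitsC`. [folklore] -/
theorem digit_ofDigitsC {C : ℕ} : ∀ {e : ℕ → ℕ} (r u : ℕ), u < r → (∀ u, u < r → e u < C) →
    digit C u (ofDigitsC C e r) = e u
  | e, 0, u, hu, _ => absurd hu (Nat.not_lt_zero _)
  | e, r + 1, 0, _, h => by rw [ofDigitsC_succ]; exact digit_mul_add_zero (h 0 (by omega)) _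
  | e, r + 1, u + 1, hu, h => by
    rw [ofDigitsC_succ, digit_mul_add_succ (h 0 (by omega))]
    exact digit_ofDigitsC r u (by omega) fun u hu => h (u + 1) (by omega)

/-! ## The index of a block-balanced set -/

/-- The pattern of `Y ⊆ ℕ` in block `u`: `{i < 3k : 3k u + i ∈ Y}`. [folklore] -/
def patternIn (k : ℕ) (Y : Finset ℕ) (u : ℕ) : Finset (Fin (3 * k)) := univ.filter fun i => u * (3 * k) + (i : ℕ) ∈ Y

/-- The digit of a pattern with `k` elements: its number under `blockEnum`. [folklore] -/
noncomputable def patternDigit (k : ℕ) (Y : Finset ℕ) (u : ℕ) : ℕ :=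
  if h : (patternIn k Y u).card = k then ((blockEnum k).symm ⟨patternIn k Y u, h⟩ : ℕ) else 0

/-- Pattern digits are `< C_k`. [folklore] -/
theorem patternDigit_lt (k : ℕ) (Y : Finset ℕ) (u : ℕ) : patternDigit k Y u < prattC k := by
  unfold patternDigit; split_ifs
  · exact Fin.is_lt _
  · exact prattC_pos k

/-- The pattern numbered by the digit of a balanced block is the pattern. [folklore] -/
theorem blockOf_patternDigit {k : ℕ} {Y : Finset ℕ} {u : ℕ} (h : (patternIn k Y u).card = k) :
    (blockOf k (patternDigit k Y u)).1 = patternIn k Y u := by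
  unfold patternDigit
  rw [dif_pos h, blockOf_val, Equiv.apply_symm_apply]

/-- **The flat index of a block-balanced set** `Y ⊆ [r · 3k]` (`k` elements in each block). [cite: Pratt2024SCC, §2 (proof of Thm. 1.9)] -/
noncomputable def idxOf (k r : ℕ) (Y : Finset ℕ) : ℕ := ofDigitsC (prattC k) (patternDigit k Y) r

/-- `idxOf < C^r`. [folklore] -/
theorem idxOf_lt (k r : ℕ) (Y : Finset ℕ) : idxOf k r Y < prattC k ^ r :=
  ofDigitsC_lt r fun u _ => patternDigit_lt k Y u

/-- The digits of `idxOf`. [folklore] -/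
theorem digit_idxOf {k r : ℕ} (Y : Finset ℕ) {u : ℕ} (hu : u < r) : digit (prattC k) u (idxOf k r Y) = patternDigit k Y u :=
  digit_ofDigitsC r u hu fun u _ => patternDigit_lt k Y u

/-- **`Aset (idxOf Y) = Y`** for a block-balanced `Y ⊆ [r · 3k]`. [cite: Pratt2024SCC, §2 (proof of Thm. 1.9)] -/
theorem Aset_idxOf {k r : ℕ} {Y : Finset ℕ} (hY : ∀ p ∈ Y, p < r * (3 * k))
    (hbal : ∀ u, u < r → (patternIn k Y u).card = k) : Aset k r (idxOf k r Y) = Y := by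
  ext p
  unfold Aset
  rw [mem_biUnion]
  constructor
  · rintro ⟨u, hu, hp⟩
    rw [mem_range] at hu
    rw [digit_idxOf Y hu] at hp
    obtain ⟨i, hi, rfl⟩ := mem_prattBlockPart.1 hp
    rw [blockOf_patternDigit (hbal u hu)] at hi
    unfold patternIn at hi
    exact (mem_filter.1 hi).2
  · intro hp
    have hlt := hY p hp
    have hk : 0 < 3 * k := Nat.pos_of_ne_zero fun h0 => by rw [h0, mul_zero] at hlt; exact Nat.not_lt_zero _ hlt
    have hu : p / (3 * k) < r := (Nat.div_lt_iff_lt_mul hk).2 hlt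
    have hpe : p / (3 * k) * (3 * k) + p % (3 * k) = p := Nat.div_add_mod' p (3 * k)
    refine ⟨p / (3 * k), mem_range.2 hu, ?_⟩
    rw [digit_idxOf Y hu, mem_prattBlockPart]
    refine ⟨⟨p % (3 * k), Nat.mod_lt _ hk⟩, ?_, hpe.symm⟩
    rw [blockOf_patternDigit (hbal _ hu)]
    unfold patternIn
    rw [mem_filter]
    exact ⟨mem_univ _, by show p / (3 * k) * (3 * k) + p % (3 * k) ∈ Y; rw [hpe]; exact hp⟩

/-- The patterns of a set are determined blockwise; disjoint sets have disjoint patterns. [folklore] -/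
theorem disjoint_patternIn {k : ℕ} {Y Z : Finset ℕ} (h : Disjoint Y Z) (u : ℕ) :
    Disjoint (patternIn k Y u) (patternIn k Z u) := by
  unfold patternIn
  rw [Finset.disjoint_left]
  intro i hi hi'
  rw [mem_filter] at hi hi'
  exact Finset.disjoint_left.1 h hi.2 hi'.2


/-! ## The input words of an instance -/

namespace PrattWords

open Literature.Computability.FineGrained Literature.Computability.FineGrained.TripartitioningInstance

variable (a : TripartitioningInstance)

/-- Family `l` (empty beyond `2`). [folklore] -/
def fam (l : ℕ) : List (Finset (Fin (3 * a.n))) := if h : l < 3 then a.F ⟨l, h⟩ else []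

/-- Its length. [folklore] -/
def len (l : ℕ) : ℕ := (fam a l).length

/-- The `j`-th listed set of family `l`. [folklore] -/
def setOf (l j : ℕ) : Finset (Fin (3 * a.n)) := (fam a l).getD j ∅

/-- The `j`-th listed set of family `l` as a set of naturals. [folklore] -/
def Sset (l j : ℕ) : Finset ℕ := (setOf a l j).image Fin.val

/-- Its sorted element words. [folklore] -/
def elems (l j : ℕ) : List ℕ := ((setOf a l j).sort (· ≤ ·)).map Fin.val

/-- The body of family `l`: the encodings of its sets. [folklore] -/
def body (l : ℕ) : List ℕ := (fam a l).flatMap encodeFinset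

/-- The block of family `l`: length word, then the body. [folklore] -/
def famBlk (l : ℕ) : List ℕ := len a l :: body a l

/-- Offset of block `l` after the header word. [folklore] -/
def off : ℕ → ℕ
  | 0 => 0
  | 1 => 1 + len a 0 * (a.n + 1)
  | _ => 1 + len a 0 * (a.n + 1) + (1 + len a 1 * (a.n + 1))

/-- Offset of block `0`. [folklore] -/
theorem off_zero : off a 0 = 0 := rfl

/-- Offset of block `1`. [folklore] -/
theorem off_one : off a 1 = 1 + len a 0 * (a.n + 1) := rfl

/-- Offset of block `2`. [folklore] -/
theorem off_two : off a 2 = 1 + len a 0 * (a.n + 1) + (1 + len a 1 * (a.n + 1)) := rfl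

/-- Listed sets are members of their family. [folklore] -/
theorem setOf_mem {l j : ℕ} (hj : j < len a l) : setOf a l j ∈ fam a l := by
  unfold setOf len at *
  rw [List.getD_eq_getElem _ _ hj]; exact List.getElem_mem hj

/-- Every listed set has `n` elements. [folklore] -/
theorem card_of_mem_fam {l : ℕ} {X : Finset (Fin (3 * a.n))} (h : X ∈ fam a l) : X.card = a.n := by
  unfold fam at h; split_ifs at h with hl
  · exact a.card_eq _ X h
  · simp at h

/-- Listed sets have `n` elements. [folklore] -/
theorem card_setOf {l j : ℕ} (hj : j < len a l) : (setOf a l j).card = a.n := card_of_mem_fam a (setOf_mem a hj)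

/-- Encodings have length `n + 1`. [folklore] -/
theorem length_encodeFinset' {X : Finset (Fin (3 * a.n))} (h : X.card = a.n) : (encodeFinset X).length = a.n + 1 := by
  unfold encodeFinset; simp [h]

/-- Reading a flat map of encodings. [folklore] -/
theorem getD_flatMap_encode : ∀ (L : List (Finset (Fin (3 * a.n)))), (∀ X ∈ L, X.card = a.n) →
    ∀ j t, j < L.length → t < a.n + 1 →
      (L.flatMap encodeFinset).getD (j * (a.n + 1) + t) 0 = (encodeFinset (L.getD j ∅)).getD t 0
  | [], _, j, t, hj, _ => absurd hj (by simp)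
  | X :: L, hL, 0, t, _, ht => by
    rw [List.flatMap_cons, zero_mul, zero_add, List.getD_append _ _ _ _ (by
      rw [length_encodeFinset' a (hL X (by simp))]; exact ht)]
    rfl
  | X :: L, hL, j + 1, t, hj, ht => by
    have hX := length_encodeFinset' a (hL X (by simp))
    rw [List.flatMap_cons, List.getD_append_right _ _ _ _ (by rw [hX]; nlinarith), hX,
      show (j + 1) * (a.n + 1) + t - (a.n + 1) = j * (a.n + 1) + t by
        rw [Nat.succ_mul]; omega]
    rw [getD_flatMap_encode L (fun Y hY => hL Y (by simp [hY])) j t (by simpa using hj) ht]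
    rfl

/-- Bodies have length `len · (n + 1)`. [folklore] -/
theorem length_body (l : ℕ) : (body a l).length = len a l * (a.n + 1) := by
  unfold body len
  have key : ∀ L : List (Finset (Fin (3 * a.n))), (∀ X ∈ L, X.card = a.n) →
      (L.flatMap encodeFinset).length = L.length * (a.n + 1) := by
    intro L hL
    induction L with
    | nil => simp
    | cons X L ih =>
      rw [List.flatMap_cons, List.length_append, length_encodeFinset' a (hL X (by simp)),
        ih (fun Y hY => hL Y (by simp [hY])), List.length_cons]
      ring
  exact key _ fun _ hX => card_of_mem_fam a hX

/-- Reading a body. [folklore] -/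
theorem getD_body {l j t : ℕ} (hj : j < len a l) (ht : t < a.n + 1) :
    (body a l).getD (j * (a.n + 1) + t) 0 = (encodeFinset (setOf a l j)).getD t 0 :=
  getD_flatMap_encode a _ (fun _ hX => card_of_mem_fam a hX) j t hj ht

/-- The word encoding is the header word followed by the three blocks. [folklore] -/
theorem wordEncode_eq : wordEncode a = a.n :: (famBlk a 0 ++ (famBlk a 1 ++ famBlk a 2)) := by
  unfold wordEncode famBlk body len fam
  simp [List.finRange_succ, List.flatMap_cons]

/-- The length of block `l`. [folklore] -/
theorem length_famBlk (l : ℕ) : (famBlk a l).length = 1 + len a l * (a.n + 1) := by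
  unfold famBlk; rw [List.length_cons, length_body]; ring

/-- The input length. [folklore] -/
theorem length_wordEncode :
    (wordEncode a).length = 1 + off a 2 + (1 + len a 2 * (a.n + 1)) := by
  rw [wordEncode_eq, List.length_cons, List.length_append, List.length_append, length_famBlk, length_famBlk, length_famBlk,
    off_two]; ring

/-- Reading block `l` inside the input. [folklore] -/
theorem getD_wordEncode_famBlk {l : ℕ} (hl : l < 3) {i : ℕ} (hi : i < (famBlk a l).length) :
    (wordEncode a).getD (1 + off a l + i) 0 = (famBlk a l).getD i 0 := by
  rw [wordEncode_eq, show 1 + off a l + i = (off a l + i) + 1 by ring, List.getD_cons_succ]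
  have h0 := length_famBlk a 0; have h1 := length_famBlk a 1
  have h2 := length_famBlk a 2
  interval_cases l
  · rw [off_zero, Nat.zero_add]
    exact List.getD_append _ _ _ _ hi
  · rw [off_one, List.getD_append_right _ _ _ _ (by omega)]
    rw [show 1 + len a 0 * (a.n + 1) + i - (famBlk a 0).length = i by omega]
    exact List.getD_append _ _ _ _ hi
  · rw [off_two, List.getD_append_right _ _ _ _ (by omega), List.getD_append_right _ _ _ _ (by omega)]
    congr 1; omega

/-- The header word. [folklore] -/
theorem getD_wordEncode_zero : (wordEncode a).getD 0 0 = a.n := by rw [wordEncode_eq]; rfl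

/-- The length word of family `l`. [folklore] -/
theorem getD_wordEncode_len {l : ℕ} (hl : l < 3) : (wordEncode a).getD (1 + off a l) 0 = len a l := by
  have := getD_wordEncode_famBlk a hl (i := 0) (by rw [length_famBlk]; omega)
  rw [Nat.add_zero] at this; rw [this]; rfl

/-- The card word of the `j`-th set of family `l`. [folklore] -/
theorem getD_wordEncode_card {l j : ℕ} (hl : l < 3) (hj : j < len a l) :
    (wordEncode a).getD (1 + off a l + 1 + j * (a.n + 1)) 0 = a.n := by
  have hrow : j * (a.n + 1) + (a.n + 1) ≤ len a l * (a.n + 1) := by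
    have := Nat.mul_le_mul_right (a.n + 1) hj; rw [Nat.succ_mul] at this; exact this
  have := getD_wordEncode_famBlk a hl (i := 1 + j * (a.n + 1)) (by rw [length_famBlk]; omega)
  rw [show 1 + off a l + (1 + j * (a.n + 1)) = 1 + off a l + 1 + j * (a.n + 1) by ring] at this
  rw [this]; unfold famBlk
  have hb := getD_body a hj (t := 0) (by omega)
  rw [Nat.add_zero] at hb
  rw [show 1 + j * (a.n + 1) = j * (a.n + 1) + 1 by ring, List.getD_cons_succ, hb]
  unfold encodeFinset; rw [List.getD_cons_zero, card_setOf a hj]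

/-- The element words of the `j`-th set of family `l`. [folklore] -/
theorem getD_wordEncode_elem {l j t : ℕ} (hl : l < 3) (hj : j < len a l) (ht : t < a.n) :
    (wordEncode a).getD (1 + off a l + 1 + j * (a.n + 1) + 1 + t) 0 = (elems a l j).getD t 0 := by
  have hrow : j * (a.n + 1) + (a.n + 1) ≤ len a l * (a.n + 1) := by
    have := Nat.mul_le_mul_right (a.n + 1) hj; rw [Nat.succ_mul] at this; exact this
  have := getD_wordEncode_famBlk a hl (i := 1 + j * (a.n + 1) + (1 + t)) (by rw [length_famBlk]; omega)
  rw [show 1 + off a l + (1 + j * (a.n + 1) + (1 + t)) = 1 + off a l + 1 + j * (a.n + 1) + 1 + t by ring] at this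
  rw [this]; unfold famBlk
  rw [show 1 + j * (a.n + 1) + (1 + t) = (j * (a.n + 1) + (t + 1)) + 1 by ring, List.getD_cons_succ,
    getD_body a hj (by omega)]
  unfold encodeFinset elems; rw [List.getD_cons_succ]

/-- The element list: length `n`, no duplicates, underlying set `Sset`, entries `< 3n`. [folklore] -/
theorem elems_props {l j : ℕ} (hj : j < len a l) :
    (elems a l j).length = a.n ∧ (elems a l j).Nodup ∧ (elems a l j).toFinset = Sset a l j ∧
      ∀ e ∈ elems a l j, e < 3 * a.n := by
  unfold elems Sset
  refine ⟨by simp [card_setOf a hj], ?_, ?_, fun e he => ?_⟩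
  · exact (Finset.sort_nodup _ _).map Fin.val_injective
  · ext e; simp
  · obtain ⟨i, _, rfl⟩ := List.mem_map.1 he; exact i.2

/-- Summing over the entries of a list. [folklore] -/
theorem sum_range_getD (f : ℕ → ℕ) : ∀ l : List ℕ, ∑ t ∈ range l.length, f (l.getD t 0) = (l.map f).sum
  | [] => by simp
  | b :: l => by
    rw [List.length_cons, sum_range_succ', List.getD_cons_zero, List.map_cons, List.sum_cons, add_comm]
    congr 1
    exact (sum_congr rfl fun t _ => by rw [List.getD_cons_succ]).trans (sum_range_getD f l)

/-- **The sum of `2^e` over the element words is the code of the set.** [folklore] -/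
theorem sum_pow_elems {l j : ℕ} (hj : j < len a l) :
    ∑ t ∈ range a.n, 2 ^ (elems a l j).getD t 0 = setCode (Sset a l j) := by
  obtain ⟨hlen, hnd, hset, _⟩ := elems_props a hj
  rw [← hlen, sum_range_getD (fun e => 2 ^ e), ← hset, setCode, List.sum_toFinset _ hnd]

/-- Elements are `< 3n`. [folklore] -/
theorem Sset_lt {l j : ℕ} : ∀ e ∈ Sset a l j, e < 3 * a.n := fun e he => by
  unfold Sset at he; obtain ⟨i, _, rfl⟩ := mem_image.1 he; exact i.2

/-- `|Sset| = n`. [folklore] -/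
theorem card_Sset {l j : ℕ} (hj : j < len a l) : (Sset a l j).card = a.n := by
  unfold Sset; rw [card_image_of_injective _ Fin.val_injective, card_setOf a hj]

/-- **Tripartition ↔ three pairwise disjoint listed sets.** [cite: Pratt2024SCC, Problem 1.3] -/
theorem hasTripartition_iff :
    a.HasTripartition ↔ ∃ j₀ j₁ j₂, j₀ < len a 0 ∧ j₁ < len a 1 ∧ j₂ < len a 2 ∧
      Disjoint (Sset a 0 j₀) (Sset a 1 j₁) ∧ Disjoint (Sset a 0 j₀) (Sset a 2 j₂) ∧ Disjoint (Sset a 1 j₁) (Sset a 2 j₂) := by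
  classical
  have hF0 : a.F 0 = fam a 0 := by unfold fam; rw [dif_pos (show (0 : ℕ) < 3 by norm_num)]; rfl
  have hF1 : a.F 1 = fam a 1 := by unfold fam; rw [dif_pos (show (1 : ℕ) < 3 by norm_num)]; rfl
  have hF2 : a.F 2 = fam a 2 := by unfold fam; rw [dif_pos (show (2 : ℕ) < 3 by norm_num)]; rfl
  -- disjointness of `n`-sets of `[3n]` versus covering
  have key : ∀ S T U : Finset (Fin (3 * a.n)), S.card = a.n → T.card = a.n → U.card = a.n →
      (S ∪ T ∪ U = univ ↔ Disjoint S T ∧ Disjoint S U ∧ Disjoint T U) := by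
    intro S T U hS hT hU
    constructor
    · intro h
      have h1 : (S ∪ T ∪ U).card = 3 * a.n := by rw [h, card_univ, Fintype.card_fin]
      have hST : (S ∪ T).card ≤ S.card + T.card := card_union_le _ _
      have h2 : (S ∪ T ∪ U).card ≤ (S ∪ T).card + U.card := card_union_le _ _
      have hSTe : (S ∪ T).card = S.card + T.card := by omega
      have h3 : (S ∪ T ∪ U).card = (S ∪ T).card + U.card := by omega
      rw [Finset.card_union_eq_card_add_card] at hSTe h3
      exact ⟨hSTe, (Finset.disjoint_union_left.1 h3).1, (Finset.disjoint_union_left.1 h3).2⟩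
    · rintro ⟨hST, hSU, hTU⟩
      apply eq_univ_of_card
      rw [card_union_of_disjoint (Finset.disjoint_union_left.2 ⟨hSU, hTU⟩), card_union_of_disjoint hST, hS, hT, hU,
        Fintype.card_fin]; ring
  have hdisj : ∀ (X Y : Finset (Fin (3 * a.n))), Disjoint (X.image Fin.val) (Y.image Fin.val) ↔ Disjoint X Y :=
    fun X Y => disjoint_image Fin.val_injective
  unfold TripartitioningInstance.HasTripartition
  constructor
  · rintro ⟨S, hS, T, hT, U, hU, h⟩
    rw [hF0] at hS; rw [hF1] at hT; rw [hF2] at hU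
    obtain ⟨j₀, hj₀, rfl⟩ := List.getElem_of_mem hS
    obtain ⟨j₁, hj₁, rfl⟩ := List.getElem_of_mem hT
    obtain ⟨j₂, hj₂, rfl⟩ := List.getElem_of_mem hU
    have e0 : (fam a 0)[j₀] = setOf a 0 j₀ := by unfold setOf; rw [List.getD_eq_getElem]
    have e1 : (fam a 1)[j₁] = setOf a 1 j₁ := by unfold setOf; rw [List.getD_eq_getElem]
    have e2 : (fam a 2)[j₂] = setOf a 2 j₂ := by unfold setOf; rw [List.getD_eq_getElem]
    rw [e0, e1, e2] at h
    rw [key _ _ _ (card_setOf a hj₀) (card_setOf a hj₁) (card_setOf a hj₂)] at h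
    refine ⟨j₀, j₁, j₂, hj₀, hj₁, hj₂, ?_, ?_, ?_⟩ <;> unfold Sset
    · exact (hdisj _ _).2 h.1
    · exact (hdisj _ _).2 h.2.1
    · exact (hdisj _ _).2 h.2.2
  · rintro ⟨j₀, j₁, j₂, hj₀, hj₁, hj₂, h01, h02, h12⟩
    refine ⟨setOf a 0 j₀, ?_, setOf a 1 j₁, ?_, setOf a 2 j₂, ?_, ?_⟩
    · rw [hF0]; exact setOf_mem a hj₀
    · rw [hF1]; exact setOf_mem a hj₁
    · rw [hF2]; exact setOf_mem a hj₂
    · rw [key _ _ _ (card_setOf a hj₀) (card_setOf a hj₁) (card_setOf a hj₂)]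
      unfold Sset at h01 h02 h12
      exact ⟨(hdisj _ _).1 h01, (hdisj _ _).1 h02, (hdisj _ _).1 h12⟩

end PrattWords

end Literature.Computability.AlgebraicComplexity
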